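import Literature.AnabelianGeometry.EtaleTheta.Discharge.Sec5Thm57Kummer
import Literature.AnabelianGeometry.EtaleTheta.Discharge.Sec5TransportsHYddOfConnectedTemperoidStrv
import Literature.AnabelianGeometry.EtaleTheta.Discharge.Sec3Rmk372GenuineBase

/-!
# [EtTh] Thm. 4.4 (iv) / Thm. 5.7 step T3 at the GENUINE §5 data: the transported bi-Kummer difference cocycle with the p. 331 defining relations DISCHARGED (pp. 317, 320, 329–331 / PDF pp. 91, 94, 103–105)

S. Mochizuki, *The étale theta function and its Frobenioid-theoretic manifestations*, Publ. RIMS **45** (2009)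
[cite: MochizukiEtTh2009, Thm 4.4 (iv) p.320 (PDF p.94); Thm 5.7 p.330 (PDF p.104); Prop 4.3 (iii) p.317 (PDF p.91); §5 p.331 (PDF p.105)].

PROOF-ONLY companion (no `def`, no instance, no new named fact; nothing landed is edited or restated).  abc-iut cell, block C
(rung LADDER-ABC:A2.C, R-C / K4 re-close), seat abc-iut-w6-d047 (gen 4), cone node **EtTh:Thm4.4(iv)** — CONE-BOARD
«RE-CLOSE (vacuous binder: F-0552, F-0553) · K4 class RECLOSABLE», abc-iut-c312-2 CONE-K4-RECLOSE v4 row 49.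

THE TWO SITES (CONE-FACT-SURGERY v4): binders #14 `hcap : 𝔉.SgpCapSpec` (FACT row F-0552) and #15 `hcup : 𝔉.SgpCupSpec`
(F-0553) of abc-iut-L2-d4's `ThetaFrobenioid.psiAut_biKummerDiff` (`Discharge/Sec5Thm57Kummer.lean`; the fifth closing
declaration of the kernel index node `N_EtTh_Thm4_4_iv`): for a self-equivalence `Ψ` transporting the root morphisms
`(s^⊓_N, s^⊔_N)` to `(e ≫ s^⊓_N ≫ D_c, e ≫ s^⊔_N ≫ D_p)` and `s^trv_N` through `e` over the base shadow `θ` (Thm. 4.4 (iv):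
"`Ψ` maps `s^trv_N` to an `O^×`-conjugate of `s^trv_N`"), the bi-Kummer difference cocycle `h ↦ s^⊓-gp_N(h)·s^⊔-gp_N(h)⁻¹` of
Prop. 4.3 (iii) / Prop. 5.2 (iii) is carried to `D_c·[(difference cocycle ∘ θ)·(Kummer cocycle of u := D_c⁻¹D_p ∘ θ)]·D_c⁻¹`
(Thm. 4.4 (iii) "compatible with the Kummer classes"; proof of Thm. 5.6 p. 329 "the Kummer class of the constant function").
Both FACT rows are `parametrised` predicates on the data-only interface `𝔉 : ThetaFrobenioid C D` whose universal closures are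
REFUTED (abc-iut-w6-d043 `Sec5BiKummerSchemaVerdicts`, p430865) — they are consumed at NAMED INSTANCES (FACT-LIST rule R5).

HERE the theorem is re-closed against the SURVIVING INSTANCE FORMS, exactly as abc-iut-w5-d020 re-closed the same two rows at
EtTh:Thm5.6(i) (`transportAtBN_ofBiKummerData`, `Discharge/Sec5TransportAtBNOfBiKummerData.lean`):
* §1 at abc-iut-L2-t4's ASSEMBLED §5 data `ThetaFrobenioid.ofBiKummerData` (any §4 setting `S`): `[Epi s^⊓_N]`, `[Epi s^⊔_N]`
  := total epimorphicity of the model Frobenioid ([FrdI] Def. 1.3 / Thm. 5.2 (ii), `epi_of_model h`); `hcap`, `hcup` := the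
  CLOSED producers `sgpCapSpec_ofBiKummerData` / `sgpCupSpec_ofBiKummerData` (0 assumption-class FACT binders) —
  `psiAut_biKummerDiff_ofBiKummerData`, `psiAut_biKummerDiff_of_central_ofBiKummerData`;
* §2 over the GENUINE connected base `D := B^temp(Π^tp_X)⁰ = ConnectedPart (BTemp X.Pi)` (abc-iut-w4-d099's
  `ThetaFrobenioid.ofConnectedTemperoidData`, `= ofBiKummerData …` definitionally, `ofConnectedTemperoidData_eq`) —
  `psiAut_biKummerDiff_ofConnectedTemperoidData`, `psiAut_biKummerDiff_of_central_ofConnectedTemperoidData`;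
* §3 END-KNIT over `B^temp(Π^tp_X)⁰`: the five Ψ-transport binders (`hT`, `hT′`, `hu`, `hstrv`, `hYdd`) are PRODUCED by
  abc-iut-w5-d245's capstone `exists_unit_transports_hYdd_ofConnectedTemperoidData_strv` (proof of Thm. 5.6 p. 328–329 /
  Thm. 5.10 (ii) p. 334; [FrdI] Prop. 5.6), whose base hypotheses «`D` of FSM-type» and «`D` slim» are THEOREMS at the
  connected part ([EtTh] Rmk. 3.7.2 as printed: `connectedPart_isOfFSMType`, `isSlim_connectedPart_bTemp`, abc-iut-f-138's
  `Sec3Rmk372GenuineBase`), so that `exists_transports_psiAut_biKummerDiff_ofConnectedTemperoidData` reads: for EVERY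
  self-equivalence `Ψ` with `α : Ψ A_N ≅ A_N`, `β : Ψ B_N ≅ B_N` preserving `Div(s^⊓_N)`, `Div(s^⊔_N)` (Prop. 5.3 (vi) clauses),
  given «`Φ` non-dilating» (Def. 3.6 (ii)), one non-group-like object, and Prop. 2.4 (every topological automorphism of `Π^tp_X`
  stabilises `Π^tp_Ÿ`), THERE EXIST a base shadow `θ`, a unit `e` of `A_N` and units `D_c, D_p` of `B_N` realising the
  transport, and the bi-Kummer difference cocycle of `ofConnectedTemperoidData` is carried by `Ψ` (read through
  `β ≪≫ D_c⁻¹`) to `(difference cocycle ∘ θ)·(Kummer cocycle of D_p ∘ θ)` — NO transport binder, NO FACT row left.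
REMAINING NAMED INPUTS (§1/§2): the Ψ-transport data `hT`, `hT′`, `hstrv`, `hYdd` BY NAME (print: Thm. 4.4 (iv) / proof of
Thm. 5.6 p. 329); (§3): `h` ([FrdI] Thm. 5.2 hypotheses of the model), `hnd`, `hN`, `hdivcap₁`/`hdivcup₁` (Prop. 5.3 (vi)),
`hP24` (Prop. 2.4) — all printed inputs, none a FACT-LIST row of class refuted-closure.
HONEST FRAMING: kernel-checked identities between typed §5 data; nothing asserts that the §5 data exist for an actual curve;
typed ≠ proved for the named binders; no side taken on [IUTchIII] Cor. 3.12. [claim: MochizukiEtTh2009, status: refereed pre-IUT]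
-/

noncomputable section

namespace Literature.AnabelianGeometry.EtaleTheta

open CategoryTheory Opposite Literature.AlgebraicGeometry.Frobenioids Literature.AnabelianGeometry.SemiGraphs
  Literature.AnabelianGeometry.SemiGraphs.GaloisObjects

universe u₀ v₀ u v w

namespace ThetaFrobenioid

/-! ### §1. At the assembled §5 data `ofBiKummerData` (any §4 setting) -/

section OfBiKummerData

variable {K : Type u₀} [Field K]
  {X : SemiGraphs.TemperedArithmeticGroup.{u₀} K} {D₀ : Type u₀} [Category.{v₀} D₀]
  {V : FrdIMonoidStub.{w}} {T₀ : RealifiedDivisorMonoids (D₀ := D₀) V} {D : Type u} [Category.{v} D]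
  {VD : FrdICatStub.{u, v, w} D} {S : BiKummerSetting X T₀ D VD}
  {pullFrac : ∀ {A A' : S.C} (_ : A' ⟶ A), S.biratUnits A → S.biratUnits A'}
  {lv N : ℕ+} {T : ThetaEnvData.{max v w} N} {θ : S.biratUnits S.Aodot} {Bl : S.C}
  {Pl : S.FractionPair θ Bl} {Rl : S.NthRoot θ Pl lv pullFrac}
  (h : ModelFrobenioid.Hypotheses S.tf.divisorMonoid S.tf.ratFnFunctor)
  (toB : ∀ A : S.C, S.biratUnits A →* S.tf.biratUnitsModel A) (Q : FrobenioidTheta.ThetaSubquotientStub.{w} D)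
  (odd_l : Odd (lv : ℕ)) (R : S.NthRoot Rl.root Rl.pair N pullFrac) (ιX : T.PiX ≃ₜ* X.Pi)
  (hopen : IsOpen ((S.galoisSurj R.AN.base R.αData.isGalois).ker : Set X.Pi)) (σ : Aut R.AN.base →* Aut R.AN)
  (K' : Type w) [Field K'] (constEmb : K'ˣ →* S.tf.biratUnitsModel R.BN)
  (constEmb_injective : Function.Injective constEmb)
  (hdivc : ∀ g : Aut R.BN.base,
    ModelFrobenioid.div ((σ ((BiKummerSetting.NthRoot.baseIso S R).conjAut.symm g)).hom ≫ R.pair.num) =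
      ModelFrobenioid.div R.pair.num)
  (hdivp : ∀ y : T.PiYdd,
    ModelFrobenioid.div ((σ (S.galoisSurj R.AN.base R.αData.isGalois (ιX y.1))).hom ≫ R.pair.den) =
      ModelFrobenioid.div R.pair.den)

/-- **T3 / Thm. 4.4 (iv) transport of the bi-Kummer difference cocycle at the ASSEMBLED §5 data `ofBiKummerData`, with the
p. 331 defining relations `SgpCapSpec` (F-0552) and `SgpCupSpec` (F-0553) and the total epimorphicity of `s^⊓_N`, `s^⊔_N`
DISCHARGED** (abc-iut-L2-t4's `sgpCapSpec_ofBiKummerData` / `sgpCupSpec_ofBiKummerData`; [FrdI] Thm. 5.2 (ii) `epi_of_model`):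
for `h ∈ H_{B_N}`,
`Ψ^Aut(s^⊓-gp_N(h)·s^⊔-gp_N(h)⁻¹) = D_c·((s^⊓-gp_N(θh)·s^⊔-gp_N(θh)⁻¹)·(s^⊔-gp_N(θh)·u·s^⊔-gp_N(θh)⁻¹·u⁻¹))·D_c⁻¹`, `u = D_c⁻¹·D_p`
— abc-iut-L2-d4's `psiAut_biKummerDiff` re-closed against the surviving instance forms of the two FACT rows; the Ψ-transport data
`hT`, `hT'`, `hstrv`, `hYdd` stay NAMED (Thm. 4.4 (iv); proof of Thm. 5.6 p. 329).
[cite: MochizukiEtTh2009, Thm 4.4 (iv) p.320 (PDF p.94); Thm 5.7 p.330 (PDF p.104); Prop 4.3 (iii) p.317 (PDF p.91)] -/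
theorem psiAut_biKummerDiff_ofBiKummerData (Ψ : S.C ≌ S.C)
    (α : Ψ.functor.obj (ofBiKummerData h toB Q odd_l R ιX hopen σ K' constEmb constEmb_injective hdivc hdivp).AN ≅
      (ofBiKummerData h toB Q odd_l R ιX hopen σ K' constEmb constEmb_injective hdivc hdivp).AN)
    (β : Ψ.functor.obj (ofBiKummerData h toB Q odd_l R ιX hopen σ K' constEmb constEmb_injective hdivc hdivp).BN ≅
      (ofBiKummerData h toB Q odd_l R ιX hopen σ K' constEmb constEmb_injective hdivc hdivp).BN)
    (e : (ofBiKummerData h toB Q odd_l R ιX hopen σ K' constEmb constEmb_injective hdivc hdivp).AN ≅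
      (ofBiKummerData h toB Q odd_l R ιX hopen σ K' constEmb constEmb_injective hdivc hdivp).AN)
    (Dc Dp : Aut (ofBiKummerData h toB Q odd_l R ιX hopen σ K' constEmb constEmb_injective hdivc hdivp).BN)
    (θΨ : Aut ((ofBiKummerData h toB Q odd_l R ιX hopen σ K' constEmb constEmb_injective hdivc hdivp).base.obj
        (ofBiKummerData h toB Q odd_l R ιX hopen σ K' constEmb constEmb_injective hdivc hdivp).BN) ≃*
      Aut ((ofBiKummerData h toB Q odd_l R ιX hopen σ K' constEmb constEmb_injective hdivc hdivp).base.obj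
        (ofBiKummerData h toB Q odd_l R ιX hopen σ K' constEmb constEmb_injective hdivc hdivp).BN))
    (hT : α.inv ≫ Ψ.functor.map (ofBiKummerData h toB Q odd_l R ιX hopen σ K' constEmb constEmb_injective hdivc hdivp).sCap ≫
        β.hom =
      e.hom ≫ (ofBiKummerData h toB Q odd_l R ιX hopen σ K' constEmb constEmb_injective hdivc hdivp).sCap ≫ Dc.hom)
    (hT' : α.inv ≫ Ψ.functor.map (ofBiKummerData h toB Q odd_l R ιX hopen σ K' constEmb constEmb_injective hdivc hdivp).sCup ≫
        β.hom =
      e.hom ≫ (ofBiKummerData h toB Q odd_l R ιX hopen σ K' constEmb constEmb_injective hdivc hdivp).sCup ≫ Dp.hom)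
    (hstrv : (ofBiKummerData h toB Q odd_l R ιX hopen σ K' constEmb constEmb_injective hdivc hdivp).StrvTransport Ψ α e θΨ)
    (hYdd : (ofBiKummerData h toB Q odd_l R ιX hopen σ K' constEmb constEmb_injective hdivc hdivp).HB.map θΨ.toMonoidHom =
      (ofBiKummerData h toB Q odd_l R ιX hopen σ K' constEmb constEmb_injective hdivc hdivp).HB)
    (hh : (ofBiKummerData h toB Q odd_l R ιX hopen σ K' constEmb constEmb_injective hdivc hdivp).HB) :
    (ofBiKummerData h toB Q odd_l R ιX hopen σ K' constEmb constEmb_injective hdivc hdivp).psiAut Ψ β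
        ((ofBiKummerData h toB Q odd_l R ιX hopen σ K' constEmb constEmb_injective hdivc hdivp).sgpCap
            (hh : Aut ((ofBiKummerData h toB Q odd_l R ιX hopen σ K' constEmb constEmb_injective hdivc hdivp).base.obj
              (ofBiKummerData h toB Q odd_l R ιX hopen σ K' constEmb constEmb_injective hdivc hdivp).BN)) *
          ((ofBiKummerData h toB Q odd_l R ιX hopen σ K' constEmb constEmb_injective hdivc hdivp).sgpCup hh)⁻¹) =
      Dc * (((ofBiKummerData h toB Q odd_l R ιX hopen σ K' constEmb constEmb_injective hdivc hdivp).sgpCap (θΨ hh) *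
          ((ofBiKummerData h toB Q odd_l R ιX hopen σ K' constEmb constEmb_injective hdivc hdivp).sgpCup
            ⟨θΨ hh, (mem_iff_of_map_equiv_eq hYdd _).mpr hh.2⟩)⁻¹) *
        ((ofBiKummerData h toB Q odd_l R ιX hopen σ K' constEmb constEmb_injective hdivc hdivp).sgpCup
            ⟨θΨ hh, (mem_iff_of_map_equiv_eq hYdd _).mpr hh.2⟩ * (Dc⁻¹ * Dp) *
          ((ofBiKummerData h toB Q odd_l R ιX hopen σ K' constEmb constEmb_injective hdivc hdivp).sgpCup
            ⟨θΨ hh, (mem_iff_of_map_equiv_eq hYdd _).mpr hh.2⟩)⁻¹ * (Dc⁻¹ * Dp)⁻¹)) * Dc⁻¹ := by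
  haveI : Epi (ofBiKummerData h toB Q odd_l R ιX hopen σ K' constEmb constEmb_injective hdivc hdivp).sCap :=
    epi_of_model (DivB := S.tf.divBNatTrans) h _
  haveI : Epi (ofBiKummerData h toB Q odd_l R ιX hopen σ K' constEmb constEmb_injective hdivc hdivp).sCup :=
    epi_of_model (DivB := S.tf.divBNatTrans) h _
  exact psiAut_biKummerDiff Ψ α β e Dc Dp θΨ
    (sgpCapSpec_ofBiKummerData h toB Q odd_l R ιX hopen σ K' constEmb constEmb_injective hdivc hdivp)
    (sgpCupSpec_ofBiKummerData h toB Q odd_l R ιX hopen σ K' constEmb constEmb_injective hdivc hdivp) hT hT' hstrv hYdd hh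

/-- **The same at `ofBiKummerData` with a unit discrepancy CENTRALISED by `Im(s^⊔-gp_N)`**: the Kummer cocycle of `u = D_c⁻¹·D_p`
is trivial and the difference cocycle is transported to its `D_c`-conjugate along `θ` ON THE NOSE — abc-iut-L2-d4's
`psiAut_biKummerDiff_of_central` with F-0552/F-0553 and `Epi` discharged (Rmk. 4.3.2: a central unit rescaling is invisible to
the mod-`N` Kummer class).  [cite: MochizukiEtTh2009, Thm 5.7 p.330 (PDF p.104); Rmk 4.3.2 p.319 (PDF p.93)] -/
theorem psiAut_biKummerDiff_of_central_ofBiKummerData (Ψ : S.C ≌ S.C)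
    (α : Ψ.functor.obj (ofBiKummerData h toB Q odd_l R ιX hopen σ K' constEmb constEmb_injective hdivc hdivp).AN ≅
      (ofBiKummerData h toB Q odd_l R ιX hopen σ K' constEmb constEmb_injective hdivc hdivp).AN)
    (β : Ψ.functor.obj (ofBiKummerData h toB Q odd_l R ιX hopen σ K' constEmb constEmb_injective hdivc hdivp).BN ≅
      (ofBiKummerData h toB Q odd_l R ιX hopen σ K' constEmb constEmb_injective hdivc hdivp).BN)
    (e : (ofBiKummerData h toB Q odd_l R ιX hopen σ K' constEmb constEmb_injective hdivc hdivp).AN ≅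
      (ofBiKummerData h toB Q odd_l R ιX hopen σ K' constEmb constEmb_injective hdivc hdivp).AN)
    (Dc Dp : Aut (ofBiKummerData h toB Q odd_l R ιX hopen σ K' constEmb constEmb_injective hdivc hdivp).BN)
    (θΨ : Aut ((ofBiKummerData h toB Q odd_l R ιX hopen σ K' constEmb constEmb_injective hdivc hdivp).base.obj
        (ofBiKummerData h toB Q odd_l R ιX hopen σ K' constEmb constEmb_injective hdivc hdivp).BN) ≃*
      Aut ((ofBiKummerData h toB Q odd_l R ιX hopen σ K' constEmb constEmb_injective hdivc hdivp).base.obj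
        (ofBiKummerData h toB Q odd_l R ιX hopen σ K' constEmb constEmb_injective hdivc hdivp).BN))
    (hT : α.inv ≫ Ψ.functor.map (ofBiKummerData h toB Q odd_l R ιX hopen σ K' constEmb constEmb_injective hdivc hdivp).sCap ≫
        β.hom =
      e.hom ≫ (ofBiKummerData h toB Q odd_l R ιX hopen σ K' constEmb constEmb_injective hdivc hdivp).sCap ≫ Dc.hom)
    (hT' : α.inv ≫ Ψ.functor.map (ofBiKummerData h toB Q odd_l R ιX hopen σ K' constEmb constEmb_injective hdivc hdivp).sCup ≫
        β.hom =
      e.hom ≫ (ofBiKummerData h toB Q odd_l R ιX hopen σ K' constEmb constEmb_injective hdivc hdivp).sCup ≫ Dp.hom)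
    (hstrv : (ofBiKummerData h toB Q odd_l R ιX hopen σ K' constEmb constEmb_injective hdivc hdivp).StrvTransport Ψ α e θΨ)
    (hYdd : (ofBiKummerData h toB Q odd_l R ιX hopen σ K' constEmb constEmb_injective hdivc hdivp).HB.map θΨ.toMonoidHom =
      (ofBiKummerData h toB Q odd_l R ιX hopen σ K' constEmb constEmb_injective hdivc hdivp).HB)
    (hcentral : ∀ h' : (ofBiKummerData h toB Q odd_l R ιX hopen σ K' constEmb constEmb_injective hdivc hdivp).HB,
      (ofBiKummerData h toB Q odd_l R ιX hopen σ K' constEmb constEmb_injective hdivc hdivp).sgpCup h' * (Dc⁻¹ * Dp) =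
        (Dc⁻¹ * Dp) * (ofBiKummerData h toB Q odd_l R ιX hopen σ K' constEmb constEmb_injective hdivc hdivp).sgpCup h')
    (hh : (ofBiKummerData h toB Q odd_l R ιX hopen σ K' constEmb constEmb_injective hdivc hdivp).HB) :
    (ofBiKummerData h toB Q odd_l R ιX hopen σ K' constEmb constEmb_injective hdivc hdivp).psiAut Ψ β
        ((ofBiKummerData h toB Q odd_l R ιX hopen σ K' constEmb constEmb_injective hdivc hdivp).sgpCap
            (hh : Aut ((ofBiKummerData h toB Q odd_l R ιX hopen σ K' constEmb constEmb_injective hdivc hdivp).base.obj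
              (ofBiKummerData h toB Q odd_l R ιX hopen σ K' constEmb constEmb_injective hdivc hdivp).BN)) *
          ((ofBiKummerData h toB Q odd_l R ιX hopen σ K' constEmb constEmb_injective hdivc hdivp).sgpCup hh)⁻¹) =
      Dc * ((ofBiKummerData h toB Q odd_l R ιX hopen σ K' constEmb constEmb_injective hdivc hdivp).sgpCap (θΨ hh) *
          ((ofBiKummerData h toB Q odd_l R ιX hopen σ K' constEmb constEmb_injective hdivc hdivp).sgpCup
            ⟨θΨ hh, (mem_iff_of_map_equiv_eq hYdd _).mpr hh.2⟩)⁻¹) * Dc⁻¹ := by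
  haveI : Epi (ofBiKummerData h toB Q odd_l R ιX hopen σ K' constEmb constEmb_injective hdivc hdivp).sCap :=
    epi_of_model (DivB := S.tf.divBNatTrans) h _
  haveI : Epi (ofBiKummerData h toB Q odd_l R ιX hopen σ K' constEmb constEmb_injective hdivc hdivp).sCup :=
    epi_of_model (DivB := S.tf.divBNatTrans) h _
  exact psiAut_biKummerDiff_of_central Ψ α β e Dc Dp θΨ
    (sgpCapSpec_ofBiKummerData h toB Q odd_l R ιX hopen σ K' constEmb constEmb_injective hdivc hdivp)
    (sgpCupSpec_ofBiKummerData h toB Q odd_l R ιX hopen σ K' constEmb constEmb_injective hdivc hdivp) hT hT' hstrv hYdd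
    hcentral hh

end OfBiKummerData

/-! ### §2. Over the GENUINE connected base `B^temp(Π^tp_X)⁰` (`ofConnectedTemperoidData`) -/

section OfConnectedTemperoidData

variable {K : Type u₀} [Field K] {X : SemiGraphs.TemperedArithmeticGroup.{u₀} K} {D₀ : Type u₀} [Category.{v₀} D₀]
  {V : FrdIMonoidStub.{w}} {T₀ : RealifiedDivisorMonoids (D₀ := D₀) V}
  {VD : FrdICatStub.{u₀ + 1, u₀, w} (ConnectedPart (BTemp X.Pi))}
  {tf : TemperedFrobenioid T₀ (ConnectedPart (BTemp X.Pi)) VD} {hZ : tf.monoidType = MonoidType.Z}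
  {hP : ∀ A : (ConnectedPart (BTemp X.Pi))ᵒᵖ, IsPerfect (tf.Φ.carrier A)}
  {NH : Subgroup (Field.absoluteGaloisGroup K) → tf.category → ℕ+ → Prop} {A₀ : tf.category}
  {hA₀ : PreFrobenioid.IsFrobeniusTrivial tf.toElem A₀} {hA₀' : SemiGraphs.IsGaloisObj A₀.base.obj}
  {pullFrac : ∀ {A A' : (BiKummerSetting.mkOfConnectedTemperoid X tf hZ hP NH A₀ hA₀ hA₀').C} (_ : A' ⟶ A),
    (BiKummerSetting.mkOfConnectedTemperoid X tf hZ hP NH A₀ hA₀ hA₀').biratUnits A →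
      (BiKummerSetting.mkOfConnectedTemperoid X tf hZ hP NH A₀ hA₀ hA₀').biratUnits A'}
  {lv N : ℕ+} {T : ThetaEnvData.{max u₀ w} N}
  {θ : (BiKummerSetting.mkOfConnectedTemperoid X tf hZ hP NH A₀ hA₀ hA₀').biratUnits
    (BiKummerSetting.mkOfConnectedTemperoid X tf hZ hP NH A₀ hA₀ hA₀').Aodot}
  {Bl : (BiKummerSetting.mkOfConnectedTemperoid X tf hZ hP NH A₀ hA₀ hA₀').C}
  {Pl : (BiKummerSetting.mkOfConnectedTemperoid X tf hZ hP NH A₀ hA₀ hA₀').FractionPair θ Bl}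
  {Rl : (BiKummerSetting.mkOfConnectedTemperoid X tf hZ hP NH A₀ hA₀ hA₀').NthRoot θ Pl lv pullFrac}
  (h : ModelFrobenioid.Hypotheses tf.divisorMonoid tf.ratFnFunctor)
  (Q : FrobenioidTheta.ThetaSubquotientStub.{w} (ConnectedPart (BTemp X.Pi))) (odd_l : Odd (lv : ℕ))
  (R : (BiKummerSetting.mkOfConnectedTemperoid X tf hZ hP NH A₀ hA₀ hA₀').NthRoot Rl.root Rl.pair N pullFrac)
  (ιX : T.PiX ≃ₜ* X.Pi) (K' : Type w) [Field K'] (constEmb : K'ˣ →* tf.biratUnitsModel R.BN)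
  (constEmb_injective : Function.Injective constEmb)
  (hinvc : ∀ g : Aut R.AN.base,
    pull tf.divisorMonoid g.hom (ModelFrobenioid.div R.pair.num) = ModelFrobenioid.div R.pair.num)
  (hinvp : ∀ y : T.PiX, y ∈ T.PiYdd →
    pull tf.divisorMonoid ((BiKummerSetting.mkOfConnectedTemperoid X tf hZ hP NH A₀ hA₀ hA₀').galoisSurj R.AN.base
      R.αData.isGalois (ιX y)).hom (ModelFrobenioid.div R.pair.den) = ModelFrobenioid.div R.pair.den)

/-- **T3 / Thm. 4.4 (iv) transport of the bi-Kummer difference cocycle over the GENUINE connected base `B^temp(Π^tp_X)⁰`, F-0552 /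
F-0553 and `Epi` DISCHARGED** (abc-iut-w4-d099's `sgpCapSpec_ofConnectedTemperoidData` / `sgpCupSpec_ofConnectedTemperoidData`;
`ofConnectedTemperoidData = ofBiKummerData …` definitionally): the statement of `psiAut_biKummerDiff` for `ofConnectedTemperoidData`
with ONLY the Ψ-transport data `hT`, `hT'`, `hstrv`, `hYdd` as named inputs.
[cite: MochizukiEtTh2009, Thm 4.4 (iv) p.320 (PDF p.94); Thm 5.7 p.330 (PDF p.104); Prop 4.3 (iii) p.317 (PDF p.91)] -/
theorem psiAut_biKummerDiff_ofConnectedTemperoidData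
    (Ψ : (BiKummerSetting.mkOfConnectedTemperoid X tf hZ hP NH A₀ hA₀ hA₀').C ≌
      (BiKummerSetting.mkOfConnectedTemperoid X tf hZ hP NH A₀ hA₀ hA₀').C)
    (α : Ψ.functor.obj (ofConnectedTemperoidData h Q odd_l R ιX K' constEmb constEmb_injective hinvc hinvp).AN ≅
      (ofConnectedTemperoidData h Q odd_l R ιX K' constEmb constEmb_injective hinvc hinvp).AN)
    (β : Ψ.functor.obj (ofConnectedTemperoidData h Q odd_l R ιX K' constEmb constEmb_injective hinvc hinvp).BN ≅
      (ofConnectedTemperoidData h Q odd_l R ιX K' constEmb constEmb_injective hinvc hinvp).BN)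
    (e : (ofConnectedTemperoidData h Q odd_l R ιX K' constEmb constEmb_injective hinvc hinvp).AN ≅
      (ofConnectedTemperoidData h Q odd_l R ιX K' constEmb constEmb_injective hinvc hinvp).AN)
    (Dc Dp : Aut (ofConnectedTemperoidData h Q odd_l R ιX K' constEmb constEmb_injective hinvc hinvp).BN)
    (θΨ : Aut ((ofConnectedTemperoidData h Q odd_l R ιX K' constEmb constEmb_injective hinvc hinvp).base.obj
        (ofConnectedTemperoidData h Q odd_l R ιX K' constEmb constEmb_injective hinvc hinvp).BN) ≃*
      Aut ((ofConnectedTemperoidData h Q odd_l R ιX K' constEmb constEmb_injective hinvc hinvp).base.obj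
        (ofConnectedTemperoidData h Q odd_l R ιX K' constEmb constEmb_injective hinvc hinvp).BN))
    (hT : α.inv ≫ Ψ.functor.map (ofConnectedTemperoidData h Q odd_l R ιX K' constEmb constEmb_injective hinvc hinvp).sCap ≫
        β.hom =
      e.hom ≫ (ofConnectedTemperoidData h Q odd_l R ιX K' constEmb constEmb_injective hinvc hinvp).sCap ≫ Dc.hom)
    (hT' : α.inv ≫ Ψ.functor.map (ofConnectedTemperoidData h Q odd_l R ιX K' constEmb constEmb_injective hinvc hinvp).sCup ≫
        β.hom =
      e.hom ≫ (ofConnectedTemperoidData h Q odd_l R ιX K' constEmb constEmb_injective hinvc hinvp).sCup ≫ Dp.hom)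
    (hstrv : (ofConnectedTemperoidData h Q odd_l R ιX K' constEmb constEmb_injective hinvc hinvp).StrvTransport Ψ α e θΨ)
    (hYdd : (ofConnectedTemperoidData h Q odd_l R ιX K' constEmb constEmb_injective hinvc hinvp).HB.map θΨ.toMonoidHom =
      (ofConnectedTemperoidData h Q odd_l R ιX K' constEmb constEmb_injective hinvc hinvp).HB)
    (hh : (ofConnectedTemperoidData h Q odd_l R ιX K' constEmb constEmb_injective hinvc hinvp).HB) :
    (ofConnectedTemperoidData h Q odd_l R ιX K' constEmb constEmb_injective hinvc hinvp).psiAut Ψ β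
        ((ofConnectedTemperoidData h Q odd_l R ιX K' constEmb constEmb_injective hinvc hinvp).sgpCap
            (hh : Aut ((ofConnectedTemperoidData h Q odd_l R ιX K' constEmb constEmb_injective hinvc hinvp).base.obj
              (ofConnectedTemperoidData h Q odd_l R ιX K' constEmb constEmb_injective hinvc hinvp).BN)) *
          ((ofConnectedTemperoidData h Q odd_l R ιX K' constEmb constEmb_injective hinvc hinvp).sgpCup hh)⁻¹) =
      Dc * (((ofConnectedTemperoidData h Q odd_l R ιX K' constEmb constEmb_injective hinvc hinvp).sgpCap (θΨ hh) *
          ((ofConnectedTemperoidData h Q odd_l R ιX K' constEmb constEmb_injective hinvc hinvp).sgpCup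
            ⟨θΨ hh, (mem_iff_of_map_equiv_eq hYdd _).mpr hh.2⟩)⁻¹) *
        ((ofConnectedTemperoidData h Q odd_l R ιX K' constEmb constEmb_injective hinvc hinvp).sgpCup
            ⟨θΨ hh, (mem_iff_of_map_equiv_eq hYdd _).mpr hh.2⟩ * (Dc⁻¹ * Dp) *
          ((ofConnectedTemperoidData h Q odd_l R ιX K' constEmb constEmb_injective hinvc hinvp).sgpCup
            ⟨θΨ hh, (mem_iff_of_map_equiv_eq hYdd _).mpr hh.2⟩)⁻¹ * (Dc⁻¹ * Dp)⁻¹)) * Dc⁻¹ :=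
  psiAut_biKummerDiff_ofBiKummerData h _ Q odd_l R ιX _ _ K' constEmb constEmb_injective _ _ Ψ α β e Dc Dp θΨ hT hT' hstrv
    hYdd hh

/-- **The centralised-discrepancy form over `B^temp(Π^tp_X)⁰`, F-0552 / F-0553 and `Epi` DISCHARGED.**
[cite: MochizukiEtTh2009, Thm 5.7 p.330 (PDF p.104); Rmk 4.3.2 p.319 (PDF p.93)] -/
theorem psiAut_biKummerDiff_of_central_ofConnectedTemperoidData
    (Ψ : (BiKummerSetting.mkOfConnectedTemperoid X tf hZ hP NH A₀ hA₀ hA₀').C ≌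
      (BiKummerSetting.mkOfConnectedTemperoid X tf hZ hP NH A₀ hA₀ hA₀').C)
    (α : Ψ.functor.obj (ofConnectedTemperoidData h Q odd_l R ιX K' constEmb constEmb_injective hinvc hinvp).AN ≅
      (ofConnectedTemperoidData h Q odd_l R ιX K' constEmb constEmb_injective hinvc hinvp).AN)
    (β : Ψ.functor.obj (ofConnectedTemperoidData h Q odd_l R ιX K' constEmb constEmb_injective hinvc hinvp).BN ≅
      (ofConnectedTemperoidData h Q odd_l R ιX K' constEmb constEmb_injective hinvc hinvp).BN)
    (e : (ofConnectedTemperoidData h Q odd_l R ιX K' constEmb constEmb_injective hinvc hinvp).AN ≅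
      (ofConnectedTemperoidData h Q odd_l R ιX K' constEmb constEmb_injective hinvc hinvp).AN)
    (Dc Dp : Aut (ofConnectedTemperoidData h Q odd_l R ιX K' constEmb constEmb_injective hinvc hinvp).BN)
    (θΨ : Aut ((ofConnectedTemperoidData h Q odd_l R ιX K' constEmb constEmb_injective hinvc hinvp).base.obj
        (ofConnectedTemperoidData h Q odd_l R ιX K' constEmb constEmb_injective hinvc hinvp).BN) ≃*
      Aut ((ofConnectedTemperoidData h Q odd_l R ιX K' constEmb constEmb_injective hinvc hinvp).base.obj
        (ofConnectedTemperoidData h Q odd_l R ιX K' constEmb constEmb_injective hinvc hinvp).BN))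
    (hT : α.inv ≫ Ψ.functor.map (ofConnectedTemperoidData h Q odd_l R ιX K' constEmb constEmb_injective hinvc hinvp).sCap ≫
        β.hom =
      e.hom ≫ (ofConnectedTemperoidData h Q odd_l R ιX K' constEmb constEmb_injective hinvc hinvp).sCap ≫ Dc.hom)
    (hT' : α.inv ≫ Ψ.functor.map (ofConnectedTemperoidData h Q odd_l R ιX K' constEmb constEmb_injective hinvc hinvp).sCup ≫
        β.hom =
      e.hom ≫ (ofConnectedTemperoidData h Q odd_l R ιX K' constEmb constEmb_injective hinvc hinvp).sCup ≫ Dp.hom)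
    (hstrv : (ofConnectedTemperoidData h Q odd_l R ιX K' constEmb constEmb_injective hinvc hinvp).StrvTransport Ψ α e θΨ)
    (hYdd : (ofConnectedTemperoidData h Q odd_l R ιX K' constEmb constEmb_injective hinvc hinvp).HB.map θΨ.toMonoidHom =
      (ofConnectedTemperoidData h Q odd_l R ιX K' constEmb constEmb_injective hinvc hinvp).HB)
    (hcentral : ∀ h' : (ofConnectedTemperoidData h Q odd_l R ιX K' constEmb constEmb_injective hinvc hinvp).HB,
      (ofConnectedTemperoidData h Q odd_l R ιX K' constEmb constEmb_injective hinvc hinvp).sgpCup h' * (Dc⁻¹ * Dp) =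
        (Dc⁻¹ * Dp) * (ofConnectedTemperoidData h Q odd_l R ιX K' constEmb constEmb_injective hinvc hinvp).sgpCup h')
    (hh : (ofConnectedTemperoidData h Q odd_l R ιX K' constEmb constEmb_injective hinvc hinvp).HB) :
    (ofConnectedTemperoidData h Q odd_l R ιX K' constEmb constEmb_injective hinvc hinvp).psiAut Ψ β
        ((ofConnectedTemperoidData h Q odd_l R ιX K' constEmb constEmb_injective hinvc hinvp).sgpCap
            (hh : Aut ((ofConnectedTemperoidData h Q odd_l R ιX K' constEmb constEmb_injective hinvc hinvp).base.obj
              (ofConnectedTemperoidData h Q odd_l R ιX K' constEmb constEmb_injective hinvc hinvp).BN)) *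
          ((ofConnectedTemperoidData h Q odd_l R ιX K' constEmb constEmb_injective hinvc hinvp).sgpCup hh)⁻¹) =
      Dc * ((ofConnectedTemperoidData h Q odd_l R ιX K' constEmb constEmb_injective hinvc hinvp).sgpCap (θΨ hh) *
          ((ofConnectedTemperoidData h Q odd_l R ιX K' constEmb constEmb_injective hinvc hinvp).sgpCup
            ⟨θΨ hh, (mem_iff_of_map_equiv_eq hYdd _).mpr hh.2⟩)⁻¹) * Dc⁻¹ :=
  psiAut_biKummerDiff_of_central_ofBiKummerData h _ Q odd_l R ιX _ _ K' constEmb constEmb_injective _ _ Ψ α β e Dc Dp θΨ hT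
    hT' hstrv hYdd hcentral hh

/-! ### §3. END-KNIT over `B^temp(Π^tp_X)⁰`: the Ψ-transport binders PRODUCED (abc-iut-w5-d245's capstone), Rmk. 3.7.2 discharged -/

set_option maxHeartbeats 400000 in
/-- **Thm. 4.4 (iv) / T3 END-KNIT at the genuine §5 data over `B^temp(Π^tp_X)⁰` — no transport binder, no FACT row.**  For every
self-equivalence `Ψ` of the tempered Frobenioid with `α : Ψ A_N ≅ A_N`, `β : Ψ B_N ≅ B_N` preserving `Div(s^⊓_N)` and `Div(s^⊔_N)`
(Prop. 5.3 (vi)), given the model hypotheses `h` ([FrdI] Thm. 5.2), «`Φ` non-dilating» (Def. 3.6 (ii)), one non-group-like object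
and Prop. 2.4 (every topological automorphism of `Π^tp_X` stabilises `Π^tp_Ÿ`): THERE EXIST a base shadow `θ_A` of `A_N^bs`
(read on `B_N^bs` through `Aut_D(A_N^bs) ⥲ Aut_D(B_N^bs)`), a unit `e ∈ O^×(A_N)` and units `D_c, D_p ∈ Aut_C(B_N)`, `D_p ∈ O^×(B_N)`,
such that `Ψ` transports `(s^⊓_N, s^⊔_N)` to `(e ≫ s^⊓_N, e ≫ s^⊔_N ≫ D_p)` read through `β ≪≫ D_c⁻¹`, transports `s^trv_N`
through `e` over `θ` (Thm. 4.4 (iv)), `θ(H_{B_N}) = H_{B_N}`, AND for every `h ∈ H_{B_N}` the bi-Kummer difference cocycle is carried to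
`(s^⊓-gp_N(θh)·s^⊔-gp_N(θh)⁻¹)·(s^⊔-gp_N(θh)·D_p·s^⊔-gp_N(θh)⁻¹·D_p⁻¹)` — the difference cocycle pulled back along `θ` TIMES the
Kummer cocycle of the unit `D_p` (Thm. 4.4 (iii) "compatible with the Kummer classes"; proof of Thm. 5.6 p. 329).  The base
hypotheses «`D` of FSM-type», «`D` slim» of the capstone are Rmk. 3.7.2 AS PRINTED at `D = B^temp(Π^tp_X)⁰`
(`connectedPart_isOfFSMType`, `isSlim_connectedPart_bTemp`).
[cite: MochizukiEtTh2009, Thm 4.4 (iv) p.320 (PDF p.94); Thm 5.6 proof p.329 (PDF p.103); Thm 5.10 (ii) p.334 (PDF p.108); Rmk 3.7.2 p.306 (PDF p.80)] -/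
theorem exists_transports_psiAut_biKummerDiff_ofConnectedTemperoidData (hnd : IsNonDilatingOn tf.divisorMonoid)
    (hN : ∃ A : (BiKummerSetting.mkOfConnectedTemperoid X tf hZ hP NH A₀ hA₀ hA₀').C,
      ¬ (PreFrobenioidData.ofModel tf.divisorMonoid tf.ratFnFunctor tf.divBNatTrans).IsGroupLikeObj A)
    (Ψ : (BiKummerSetting.mkOfConnectedTemperoid X tf hZ hP NH A₀ hA₀ hA₀').C ≌
      (BiKummerSetting.mkOfConnectedTemperoid X tf hZ hP NH A₀ hA₀ hA₀').C)
    (α : Ψ.functor.obj (ofConnectedTemperoidData h Q odd_l R ιX K' constEmb constEmb_injective hinvc hinvp).AN ≅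
      (ofConnectedTemperoidData h Q odd_l R ιX K' constEmb constEmb_injective hinvc hinvp).AN)
    (β : Ψ.functor.obj (ofConnectedTemperoidData h Q odd_l R ιX K' constEmb constEmb_injective hinvc hinvp).BN ≅
      (ofConnectedTemperoidData h Q odd_l R ιX K' constEmb constEmb_injective hinvc hinvp).BN)
    (hdivcap₁ : (ofConnectedTemperoidData h Q odd_l R ιX K' constEmb constEmb_injective hinvc hinvp).pre.div
        (α.inv ≫ Ψ.functor.map (ofConnectedTemperoidData h Q odd_l R ιX K' constEmb constEmb_injective hinvc hinvp).sCap ≫ β.hom) =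
      (ofConnectedTemperoidData h Q odd_l R ιX K' constEmb constEmb_injective hinvc hinvp).pre.div
        (ofConnectedTemperoidData h Q odd_l R ιX K' constEmb constEmb_injective hinvc hinvp).sCap)
    (hdivcup₁ : (ofConnectedTemperoidData h Q odd_l R ιX K' constEmb constEmb_injective hinvc hinvp).pre.div
        (α.inv ≫ Ψ.functor.map (ofConnectedTemperoidData h Q odd_l R ιX K' constEmb constEmb_injective hinvc hinvp).sCup ≫ β.hom) =
      (ofConnectedTemperoidData h Q odd_l R ιX K' constEmb constEmb_injective hinvc hinvp).pre.div
        (ofConnectedTemperoidData h Q odd_l R ιX K' constEmb constEmb_injective hinvc hinvp).sCup)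
    (hP24 : ∀ γ : T.PiX ≃ₜ* T.PiX, T.PiYdd.map γ.toMulEquiv.toMonoidHom = T.PiYdd) :
    ∃ θA : Aut R.AN.base ≃* Aut R.AN.base,
      ∃ e ∈ (ofConnectedTemperoidData h Q odd_l R ιX K' constEmb constEmb_injective hinvc hinvp).units
          (ofConnectedTemperoidData h Q odd_l R ιX K' constEmb constEmb_injective hinvc hinvp).AN,
        ∃ Dc Dp : Aut (ofConnectedTemperoidData h Q odd_l R ιX K' constEmb constEmb_injective hinvc hinvp).BN,
        ∃ hYdd : (ofConnectedTemperoidData h Q odd_l R ιX K' constEmb constEmb_injective hinvc hinvp).HB.map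
              ((((ofConnectedTemperoidData h Q odd_l R ιX K' constEmb constEmb_injective hinvc hinvp).autBaseIsoAB.symm.trans
                  θA).trans
                (ofConnectedTemperoidData h Q odd_l R ιX K' constEmb constEmb_injective hinvc hinvp).autBaseIsoAB).toMonoidHom) =
            (ofConnectedTemperoidData h Q odd_l R ιX K' constEmb constEmb_injective hinvc hinvp).HB,
          α.inv ≫ Ψ.functor.map (ofConnectedTemperoidData h Q odd_l R ιX K' constEmb constEmb_injective hinvc hinvp).sCap ≫
              (β ≪≫ Dc.symm).hom =
            e.hom ≫ (ofConnectedTemperoidData h Q odd_l R ιX K' constEmb constEmb_injective hinvc hinvp).sCap ≫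
              (1 : Aut (ofConnectedTemperoidData h Q odd_l R ιX K' constEmb constEmb_injective hinvc hinvp).BN).hom ∧
          α.inv ≫ Ψ.functor.map (ofConnectedTemperoidData h Q odd_l R ιX K' constEmb constEmb_injective hinvc hinvp).sCup ≫
              (β ≪≫ Dc.symm).hom =
            e.hom ≫ (ofConnectedTemperoidData h Q odd_l R ιX K' constEmb constEmb_injective hinvc hinvp).sCup ≫ Dp.hom ∧
          Dp ∈ (ofConnectedTemperoidData h Q odd_l R ιX K' constEmb constEmb_injective hinvc hinvp).units
            (ofConnectedTemperoidData h Q odd_l R ιX K' constEmb constEmb_injective hinvc hinvp).BN ∧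
          (ofConnectedTemperoidData h Q odd_l R ιX K' constEmb constEmb_injective hinvc hinvp).StrvTransport Ψ α e
            (((ofConnectedTemperoidData h Q odd_l R ιX K' constEmb constEmb_injective hinvc hinvp).autBaseIsoAB.symm.trans θA).trans
              (ofConnectedTemperoidData h Q odd_l R ιX K' constEmb constEmb_injective hinvc hinvp).autBaseIsoAB) ∧
          ∀ hh : (ofConnectedTemperoidData h Q odd_l R ιX K' constEmb constEmb_injective hinvc hinvp).HB,
            (ofConnectedTemperoidData h Q odd_l R ιX K' constEmb constEmb_injective hinvc hinvp).psiAut Ψ (β ≪≫ Dc.symm)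
                ((ofConnectedTemperoidData h Q odd_l R ιX K' constEmb constEmb_injective hinvc hinvp).sgpCap
            (hh : Aut ((ofConnectedTemperoidData h Q odd_l R ιX K' constEmb constEmb_injective hinvc hinvp).base.obj
              (ofConnectedTemperoidData h Q odd_l R ιX K' constEmb constEmb_injective hinvc hinvp).BN)) *
                  ((ofConnectedTemperoidData h Q odd_l R ιX K' constEmb constEmb_injective hinvc hinvp).sgpCup hh)⁻¹) =
              ((ofConnectedTemperoidData h Q odd_l R ιX K' constEmb constEmb_injective hinvc hinvp).sgpCap
                    ((((ofConnectedTemperoidData h Q odd_l R ιX K' constEmb constEmb_injective hinvc hinvp).autBaseIsoAB.symm.trans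
                        θA).trans
                      (ofConnectedTemperoidData h Q odd_l R ιX K' constEmb constEmb_injective hinvc hinvp).autBaseIsoAB) hh) *
                  ((ofConnectedTemperoidData h Q odd_l R ιX K' constEmb constEmb_injective hinvc hinvp).sgpCup
                    ⟨(((ofConnectedTemperoidData h Q odd_l R ιX K' constEmb constEmb_injective hinvc hinvp).autBaseIsoAB.symm.trans
                        θA).trans
                      (ofConnectedTemperoidData h Q odd_l R ιX K' constEmb constEmb_injective hinvc hinvp).autBaseIsoAB) hh,
                      (mem_iff_of_map_equiv_eq hYdd _).mpr hh.2⟩)⁻¹) *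
                ((ofConnectedTemperoidData h Q odd_l R ιX K' constEmb constEmb_injective hinvc hinvp).sgpCup
                    ⟨(((ofConnectedTemperoidData h Q odd_l R ιX K' constEmb constEmb_injective hinvc hinvp).autBaseIsoAB.symm.trans
                        θA).trans
                      (ofConnectedTemperoidData h Q odd_l R ιX K' constEmb constEmb_injective hinvc hinvp).autBaseIsoAB) hh,
                      (mem_iff_of_map_equiv_eq hYdd _).mpr hh.2⟩ * Dp *
                  ((ofConnectedTemperoidData h Q odd_l R ιX K' constEmb constEmb_injective hinvc hinvp).sgpCup
                    ⟨(((ofConnectedTemperoidData h Q odd_l R ιX K' constEmb constEmb_injective hinvc hinvp).autBaseIsoAB.symm.trans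
                        θA).trans
                      (ofConnectedTemperoidData h Q odd_l R ιX K' constEmb constEmb_injective hinvc hinvp).autBaseIsoAB) hh,
                      (mem_iff_of_map_equiv_eq hYdd _).mpr hh.2⟩)⁻¹ * Dp⁻¹) := by
  obtain ⟨θA, e, he, Dc, Dp, hT, hT', hu, hstrv, hYdd⟩ :=
    exists_unit_transports_hYdd_ofConnectedTemperoidData_strv h Q odd_l R ιX K' constEmb constEmb_injective hinvc hinvp
      QuasiTemperoid.BTempConnected.connectedPart_isOfFSMType (isSlim_connectedPart_bTemp X.isTempered X.isSlimGroup) hnd hN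
      Ψ α β hdivcap₁ hdivcup₁ hP24
  refine ⟨θA, e, he, Dc, Dp, hYdd, hT, hT', hu, hstrv, fun hh => ?_⟩
  rw [psiAut_biKummerDiff_ofConnectedTemperoidData h Q odd_l R ιX K' constEmb constEmb_injective hinvc hinvp Ψ α (β ≪≫ Dc.symm)
    e 1 Dp _ hT hT' hstrv hYdd hh]
  simp only [inv_one, one_mul, mul_one]

end OfConnectedTemperoidData

end ThetaFrobenioid

end Literature.AnabelianGeometry.EtaleTheta

end
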